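import Literature.Geometry.DiscreteGeometry.ShellCensusReplaySound
import HarnessLib

/-!
# Census certificates with degree escapes and a facet leaf: claims, enclosures, the checker

Topic `Literature/Geometry/DiscreteGeometry`; replayer EXTENSION for the certificate stubs
`stub_ffrC5NoOpenStar` / `stub_ffrC5NoFarFacet` of crux `FiveFoldRationingR`
(stmt-AtomisticToContinuum-18071) and the sibling request `defn-ShellTrichotomyReplay`
(stmt-18070). Part 1 of 3: the extended claims, the facet polynomial and its enclosure, the
certificate trees, the checker, and a toy census checked in the kernel; soundness of the checker in
`ShellCensusReplayEscapeSound.lean` (part 2), the text decoder in `ShellCensusReplayEscapeText.lean`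
(part 3). Built on the replayer `ShellCensusReplay.lean` / `ShellCensusReplaySound.lean` (`Spec`,
`Admissible`, `Sat`, boxes and `cIv`/`sqNormIv`, `Witness`, `witnessOK`, `acceptOK`, `relabel`,
`permOK`), whose tests and rule-soundness lemmas are reused verbatim, and on
`Literature/Analysis/ValidatedNumerics` (`mooreMul`, `sqrtI`, inclusion theorems). All certificate
data and tests are COMPUTABLE (structural recursion, `decide` on `ℚ`; `decide +kernel` on toys,
`native_decide` on the lane's certificates).

## The extended claim language

The claims of `ShellCensusReplay` (`Spec.Claim S`: every admissible tuple satisfying the decided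
pairs `S` is `Good`) get two more HYPOTHESES on the tuple `t`:

* a DEGREE WINDOW `Spec.DegOK dmin dmax t`: every label `k` has between `dmin` and `dmax` bonded
  partners (`l ≠ k`, `dist (t k) (t l) ≤ dhi`);
* an optional FACET CONDITION `Spec.FacetLE f t` on three labels `f = some (p, q, r)`:
  `facetPoly (t p) (t q) (t r) (t l) ≤ 0` for every label `l`, where
  `facetPoly x y z w = det[x,y,z] · (‖x‖ det[y,z,w] − ‖y‖ det[x,z,w] + ‖z‖ det[x,y,w] − ‖w‖ det[x,y,z])`
  (rows = coordinates) — the sign condition a supporting plane of the normalised shell through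
  `p, q, r` imposes (`det[x,y,z] · det[y−x, z−x, w−x] ≤ 0` after normalising); `f = none`: nothing.

`Spec.EClaim Q dmin dmax f S`: every admissible `t` in the degree window, with the facet condition,
satisfying `S`, is `Good Q t` (so every rule lemma of `ShellCensusReplaySound` applies). With NO
anchors `Good` is `False`: an established `EClaim` is an INFEASIBILITY statement
(`Spec.EClaim.elim_nil`, `Spec.emptyPatterns`) — the intended use. `facetPoly` is invariant under
linear isometries (`facetPoly_map`, via the Gram form `det[a,b,c] · det[d,e,f] = det (⟪rowᵢ, colⱼ⟫)`),
which is what the frame rule needs; `facetIv` encloses it on a box (`facetPoly_mem_facetIv`: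
Moore products of coordinate intervals for the determinants, `sqrtI` of `sqNormIv` for the norms).

## Certificates (`ETree`, `ECensus`) and the checker (`ETree.check`, `ECensus.check`)

The trees of `ShellCensusReplay.Tree` (`case`, `ref`, `frame`, `split`, `empty`, `accept`: same
tests, `case`/`ref` usable before and after framing) with three new LEAVES: `torn k` (the labels
decided FAR from `k` in `S` number `≥ n − dmin`, so `k` cannot reach degree `dmin`; requires
`dhi < gap`), `capped k` (the labels decided BONDED to `k` number `> dmax`), and, inside a frame,
`aboveFacet l prec` (`f = some (p,q,r)` and the lower end of `facetIv prec B p q r l` is `> 0`).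
Rule `ref` additionally requires the relabelling to FIX `p, q, r` when `f = some (p,q,r)`
(`fixesB`). `ECensus.check P dmin dmax f S C`: `okB`, every entry checks against the context of the
earlier ones, and some entry has the target constraint list `S`. Metric degree arguments inside a
box are expressed with `case k l` + `empty (bondHi k l)` / `empty (farLo k l)` before `torn` /
`capped`.

## References
* R. E. Moore, *Interval Analysis* (1966), Theorem 3.1 (inclusion property), §4.4 (exclusion
  by subdivision). [cite: Moore1966, Theorem 3.1, §4.4]
-/

namespace Literature.Geometry.DiscreteGeometry

open Literature.Analysis.ValidatedNumerics NonemptyInterval Finset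
open scoped RealInnerProductSpace

/-- Euclidean `3`-space. -/
local notation "E3" => EuclideanSpace ℝ (Fin 3)

namespace ShellCensus

/-! ### The extended claims -/

/-- **The facet polynomial** of four points (rows = coordinates):
`det[x,y,z] · (‖x‖ det[y,z,w] − ‖y‖ det[x,z,w] + ‖z‖ det[x,y,w] − ‖w‖ det[x,y,z])`. [folklore] -/
noncomputable def facetPoly (x y z w : E3) : ℝ :=
  Matrix.det !![x 0, x 1, x 2; y 0, y 1, y 2; z 0, z 1, z 2] *
    (‖x‖ * Matrix.det !![y 0, y 1, y 2; z 0, z 1, z 2; w 0, w 1, w 2]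
      - ‖y‖ * Matrix.det !![x 0, x 1, x 2; z 0, z 1, z 2; w 0, w 1, w 2]
      + ‖z‖ * Matrix.det !![x 0, x 1, x 2; y 0, y 1, y 2; w 0, w 1, w 2]
      - ‖w‖ * Matrix.det !![x 0, x 1, x 2; y 0, y 1, y 2; z 0, z 1, z 2])

namespace Spec

variable (P : Spec)

/-- **Degree window**: every label has between `dmin` and `dmax` bonded partners. [folklore] -/
def DegOK (dmin dmax : ℕ) (t : Fin P.n → E3) : Prop :=
  ∀ k : Fin P.n, dmin ≤ (Finset.univ.filter fun l => l ≠ k ∧ dist (t k) (t l) ≤ (P.dhi : ℝ)).card ∧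
    (Finset.univ.filter fun l => l ≠ k ∧ dist (t k) (t l) ≤ (P.dhi : ℝ)).card ≤ dmax

/-- **Facet condition** on the labels `f = some (p, q, r)` (nothing if `f = none` or an index is
out of range): `facetPoly (t p) (t q) (t r) (t l) ≤ 0` for every label `l`. [folklore] -/
def FacetLE (f : Option (ℕ × ℕ × ℕ)) (t : Fin P.n → E3) : Prop :=
  match f with
  | none => True
  | some (p, q, r) => ∀ (hp : p < P.n) (hq : q < P.n) (hr : r < P.n) (l : Fin P.n),
      facetPoly (t ⟨p, hp⟩) (t ⟨q, hq⟩) (t ⟨r, hr⟩) (t l) ≤ 0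

/-- The facet condition from its natural form (all labels in range). [folklore] -/
theorem FacetLE.of_forall {P : Spec} {p q r : ℕ} (hp : p < P.n) (hq : q < P.n) (hr : r < P.n)
    {t : Fin P.n → E3} (h : ∀ l, facetPoly (t ⟨p, hp⟩) (t ⟨q, hq⟩) (t ⟨r, hr⟩) (t l) ≤ 0) :
    P.FacetLE (some (p, q, r)) t := fun _ _ _ l => h l

/-- **The extended claim of a constraint list** (frame-free): every admissible configuration in
the degree window, with the facet condition, satisfying the constraints, is good. [folklore] -/
def EClaim (Q : P.Patterns) (dmin dmax : ℕ) (f : Option (ℕ × ℕ × ℕ)) (S : List Constraint) : Prop :=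
  ∀ t : Fin P.n → E3, P.Admissible t → P.DegOK dmin dmax t → P.FacetLE f t → P.Sat S t → P.Good Q t

/-- The extended claim of a framed node (the flattened tuple lies in the box `B`). [folklore] -/
def EFClaim (Q : P.Patterns) (dmin dmax : ℕ) (f : Option (ℕ × ℕ × ℕ)) (S : List Constraint)
    (B : Box) : Prop :=
  ∀ t : Fin P.n → E3, P.Admissible t → P.DegOK dmin dmax t → P.FacetLE f t → P.Sat S t →
    B.mem (flat t) → P.Good Q t

/-- The extended claim of a node of the search (frame-free or framed). [folklore] -/
def ENodeClaim (Q : P.Patterns) (dmin dmax : ℕ) (f : Option (ℕ × ℕ × ℕ)) (S : List Constraint) :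
    Option Box → Prop
  | none => P.EClaim Q dmin dmax f S
  | some B => P.EFClaim Q dmin dmax f S B

/-- With no anchors there are no patterns, so an established extended claim is an
**infeasibility statement**. [folklore] -/
theorem EClaim.elim_nil {P : Spec} {Q : P.Patterns} {dmin dmax : ℕ} {f : Option (ℕ × ℕ × ℕ)}
    {S : List Constraint} (hA : P.anchors = []) (h : P.EClaim Q dmin dmax f S) :
    ∀ t : Fin P.n → E3, P.Admissible t → P.DegOK dmin dmax t → P.FacetLE f t → P.Sat S t →
      False := by
  intro t ht hdeg hf hS
  obtain ⟨i, hi, -⟩ := h t ht hdeg hf hS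
  have h0 : Q.pts.length = 0 := by rw [Q.len_eq, hA]; rfl
  omega

/-- The (empty) family of exact patterns of a specification without anchors. [folklore] -/
def emptyPatterns (hA : P.anchors = []) : P.Patterns where
  pts := []
  len_eq := by rw [hA]; rfl
  close i hi _ := absurd hi (by simp)

end Spec

/-! ### The facet polynomial: explicit form, Gram form, isometry invariance -/

/-- Cofactor expansion of the determinant of three rows. [folklore] -/
theorem det_rows_fin3 (a b c : E3) :
    Matrix.det !![a 0, a 1, a 2; b 0, b 1, b 2; c 0, c 1, c 2] =
      a 0 * (b 1 * c 2 - b 2 * c 1) - a 1 * (b 0 * c 2 - b 2 * c 0) + a 2 * (b 0 * c 1 - b 1 * c 0) := by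
  simp only [Matrix.det_fin_three, Matrix.of_apply, Matrix.cons_val', Matrix.cons_val_zero,
    Matrix.cons_val_one, Matrix.cons_val_two, Matrix.cons_val_fin_one, Matrix.empty_val',
    Matrix.head_cons, Matrix.tail_cons, Matrix.head_fin_const]
  ring

/-- The Gram-type determinant `det (⟪rowᵢ, colⱼ⟫)` of the triples `(a, b, c)` and `(d, e, f)`. [folklore] -/
noncomputable def gram3 (a b c d e f : E3) : ℝ :=
  ⟪a, d⟫ * (⟪b, e⟫ * ⟪c, f⟫ - ⟪b, f⟫ * ⟪c, e⟫) - ⟪a, e⟫ * (⟪b, d⟫ * ⟪c, f⟫ - ⟪b, f⟫ * ⟪c, d⟫)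
    + ⟪a, f⟫ * (⟪b, d⟫ * ⟪c, e⟫ - ⟪b, e⟫ * ⟪c, d⟫)

/-- `det[a,b,c] · det[d,e,f] = det (⟪rowᵢ, colⱼ⟫)` (Cauchy–Binet for `3 × 3`, as a polynomial
identity in the coordinates). [folklore] -/
theorem det_mul_det_eq_gram3 (a b c d e f : E3) :
    Matrix.det !![a 0, a 1, a 2; b 0, b 1, b 2; c 0, c 1, c 2] *
      Matrix.det !![d 0, d 1, d 2; e 0, e 1, e 2; f 0, f 1, f 2] = gram3 a b c d e f := by
  simp only [det_rows_fin3, gram3, inner_fin3]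
  ring

/-- The facet polynomial in Gram form: norms times Gram-type determinants. [folklore] -/
theorem facetPoly_eq_gram3 (x y z w : E3) : facetPoly x y z w =
    ‖x‖ * gram3 x y z y z w - ‖y‖ * gram3 x y z x z w + ‖z‖ * gram3 x y z x y w
      - ‖w‖ * gram3 x y z x y z := by
  rw [← det_mul_det_eq_gram3 x y z y z w, ← det_mul_det_eq_gram3 x y z x z w,
    ← det_mul_det_eq_gram3 x y z x y w, ← det_mul_det_eq_gram3 x y z x y z, facetPoly]
  ring

/-- The Gram-type determinant is invariant under linear isometries. [folklore] -/
theorem gram3_map (A : E3 ≃ₗᵢ[ℝ] E3) (a b c d e f : E3) :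
    gram3 (A a) (A b) (A c) (A d) (A e) (A f) = gram3 a b c d e f := by
  simp only [gram3, LinearIsometryEquiv.inner_map_map]

/-- **The facet polynomial is invariant under linear isometries** (so the facet condition
survives the frame normalisation). [folklore] -/
theorem facetPoly_map (A : E3 ≃ₗᵢ[ℝ] E3) (x y z w : E3) :
    facetPoly (A x) (A y) (A z) (A w) = facetPoly x y z w := by
  simp only [facetPoly_eq_gram3, gram3_map, LinearIsometryEquiv.norm_map]

/-! ### Interval enclosures of determinants, norms and the facet polynomial -/

/-- Enclosure of `det[t p, t q, t r]` (cofactor expansion, Moore products). [cite: Moore1966, Theorem 3.1] -/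
def detIv (B : Box) (p q r : ℕ) : NonemptyInterval ℚ :=
  (cIv B p 0).mooreMul ((cIv B q 1).mooreMul (cIv B r 2) - (cIv B q 2).mooreMul (cIv B r 1))
    - (cIv B p 1).mooreMul ((cIv B q 0).mooreMul (cIv B r 2) - (cIv B q 2).mooreMul (cIv B r 0))
    + (cIv B p 2).mooreMul ((cIv B q 0).mooreMul (cIv B r 1) - (cIv B q 1).mooreMul (cIv B r 0))

/-- Enclosure of `‖t k‖` (`sqrtI` of `sqNormIv`, dyadic precision `prec`, six Heron steps). [cite: Moore1966, Theorem 3.1] -/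
def normIv (prec : ℕ) (B : Box) (k : ℕ) : NonemptyInterval ℚ := (sqNormIv B k).sqrtI prec 6

/-- Enclosure of `facetPoly (t p) (t q) (t r) (t l)`. [cite: Moore1966, Theorem 3.1] -/
def facetIv (prec : ℕ) (B : Box) (p q r l : ℕ) : NonemptyInterval ℚ :=
  (detIv B p q r).mooreMul
    ((normIv prec B p).mooreMul (detIv B q r l) - (normIv prec B q).mooreMul (detIv B p r l)
      + (normIv prec B r).mooreMul (detIv B p q l) - (normIv prec B l).mooreMul (detIv B p q r))

/-! ### Inclusion properties of the enclosures -/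

section Enclosures

variable {n : ℕ} {B : Box} {t : Fin n → E3}

/-- Inclusion property of `detIv`. [cite: Moore1966, Theorem 3.1] -/
theorem det_mem_detIv (hB : B.mem (flat t)) (p q r : Fin n) :
    Matrix.det !![t p 0, t p 1, t p 2; t q 0, t q 1, t q 2; t r 0, t r 1, t r 2] ∈
      (detIv B p q r).ratCast ℝ := by
  rw [det_rows_fin3]
  exact isSoundFun₂_add (isSoundFun₂_sub
    (isSoundFun₂_mooreMul (coord_mem hB p 0) (isSoundFun₂_sub
      (isSoundFun₂_mooreMul (coord_mem hB q 1) (coord_mem hB r 2))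
      (isSoundFun₂_mooreMul (coord_mem hB q 2) (coord_mem hB r 1))))
    (isSoundFun₂_mooreMul (coord_mem hB p 1) (isSoundFun₂_sub
      (isSoundFun₂_mooreMul (coord_mem hB q 0) (coord_mem hB r 2))
      (isSoundFun₂_mooreMul (coord_mem hB q 2) (coord_mem hB r 0)))))
    (isSoundFun₂_mooreMul (coord_mem hB p 2) (isSoundFun₂_sub
      (isSoundFun₂_mooreMul (coord_mem hB q 0) (coord_mem hB r 1))
      (isSoundFun₂_mooreMul (coord_mem hB q 1) (coord_mem hB r 0))))

/-- Inclusion property of `normIv`. [cite: Moore1966, Theorem 3.1] -/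
theorem norm_mem_normIv (hB : B.mem (flat t)) (prec : ℕ) (k : Fin n) :
    ‖t k‖ ∈ (normIv prec B k).ratCast ℝ := by
  have h := sqrt_mem_sqrtI prec 6 (norm_sq_mem hB k)
  rwa [Real.sqrt_sq (norm_nonneg _)] at h

/-- **Inclusion property of `facetIv`.** [cite: Moore1966, Theorem 3.1] -/
theorem facetPoly_mem_facetIv (hB : B.mem (flat t)) (prec : ℕ) (p q r l : Fin n) :
    facetPoly (t p) (t q) (t r) (t l) ∈ (facetIv prec B p q r l).ratCast ℝ := by
  unfold facetPoly facetIv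
  exact isSoundFun₂_mooreMul (det_mem_detIv hB p q r)
    (isSoundFun₂_sub (isSoundFun₂_add (isSoundFun₂_sub
      (isSoundFun₂_mooreMul (norm_mem_normIv hB prec p) (det_mem_detIv hB q r l))
      (isSoundFun₂_mooreMul (norm_mem_normIv hB prec q) (det_mem_detIv hB p r l)))
      (isSoundFun₂_mooreMul (norm_mem_normIv hB prec r) (det_mem_detIv hB p q l)))
      (isSoundFun₂_mooreMul (norm_mem_normIv hB prec l) (det_mem_detIv hB p q r)))

end Enclosures

/-! ### The new tests -/

/-- The relabelling `π` fixes the facet labels (vacuous without a facet condition). [folklore] -/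
def fixesB (f : Option (ℕ × ℕ × ℕ)) (π : List ℕ) : Bool :=
  match f with
  | none => true
  | some (p, q, r) => (papp π p == p) && (papp π q == q) && (papp π r == r)

namespace Spec

variable (P : Spec)

/-- The labels `l ≠ k` decided FAR from `k` in `S`. [folklore] -/
def farSet (S : List Constraint) (k : ℕ) : Finset (Fin P.n) :=
  Finset.univ.filter fun l => (l : ℕ) ≠ k ∧ ((k, (l : ℕ), false) ∈ S ∨ ((l : ℕ), k, false) ∈ S)

/-- The labels `l ≠ k` decided BONDED to `k` in `S`. [folklore] -/
def bondSet (S : List Constraint) (k : ℕ) : Finset (Fin P.n) :=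
  Finset.univ.filter fun l => (l : ℕ) ≠ k ∧ ((k, (l : ℕ), true) ∈ S ∨ ((l : ℕ), k, true) ∈ S)

/-- **Test `torn k`**: `dhi < gap` and at least `n − dmin` labels are decided far from `k`, so
fewer than `dmin` labels can be bonded to `k`. [folklore] -/
def tornOK (dmin : ℕ) (S : List Constraint) (k : ℕ) : Bool :=
  decide (k < P.n) && decide (P.dhi < P.gap) && decide (P.n ≤ dmin + (P.farSet S k).card)

/-- **Test `capped k`**: more than `dmax` labels are decided bonded to `k`. [folklore] -/
def cappedOK (dmax : ℕ) (S : List Constraint) (k : ℕ) : Bool :=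
  decide (k < P.n) && decide (dmax < (P.bondSet S k).card)

/-- **Test `aboveFacet l prec`**: there is a facet condition on `(p, q, r)`, all indices are in
range, and the interval lower bound of `facetPoly (t p) (t q) (t r) (t l)` on the box is
positive. [cite: Moore1966, Theorem 3.1, §4.4] -/
def facetOK (f : Option (ℕ × ℕ × ℕ)) (B : Box) (l prec : ℕ) : Bool :=
  match f with
  | none => false
  | some (p, q, r) => decide (p < P.n) && decide (q < P.n) && decide (r < P.n) &&
      decide (l < P.n) && decide (0 < (facetIv prec B p q r l).fst)

end Spec

/-! ### Certificates and the checker -/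

/-- **Extended census certificate trees**: the trees of `ShellCensusReplay.Tree` with the degree
escapes `torn`, `capped` and the facet leaf `aboveFacet`. [folklore] -/
inductive ETree : Type
  /-- case split on the pair `(k, l)` -/
  | case (k l : ℕ) (bond far : ETree)
  /-- back-reference to claim `j` of the context, relabelled -/
  | ref (perm : List ℕ) (j : ℕ)
  /-- degree escape: `k` has too many decided far partners -/
  | torn (k : ℕ)
  /-- degree escape: `k` has too many decided bonds -/
  | capped (k : ℕ)
  /-- fix the frame -/
  | frame (sub : ETree)
  /-- bisect coordinate `axis` at `cut` -/
  | split (axis : ℕ) (cut : ℚ) (lo hi : ETree)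
  /-- excluded box -/
  | empty (w : Witness)
  /-- the facet polynomial at label `l` is positive on the box (precision `prec`) -/
  | aboveFacet (l : ℕ) (prec : ℕ)
  /-- accepted box -/
  | accept (pat : ℕ) (mat : List ℚ) (perm : List ℕ)
  deriving Inhabited, DecidableEq

/-- **The extended certificate checker** (structural recursion; kernel-evaluable): as
`Tree.check`, with the degree window `[dmin, dmax]`, the facet labels `f`, and the three new
leaves. [folklore] -/
def ETree.check (P : Spec) (dmin dmax : ℕ) (f : Option (ℕ × ℕ × ℕ)) (ctx : Array (List Constraint)) :
    List Constraint → Option Box → ETree → Bool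
  | S, ob, .case k l tb tf => decide (k < P.n) && decide (l < P.n) && !(k == l) &&
      ETree.check P dmin dmax f ctx ((k, l, true) :: S) ob tb &&
        ETree.check P dmin dmax f ctx ((k, l, false) :: S) ob tf
  | S, _, .ref π j =>
      match ctx[j]? with
      | none => false
      | some S₀ => permOK P.n π && fixesB f π && (relabel π S₀).all fun c => decide (c ∈ S)
  | S, _, .torn k => P.tornOK dmin S k
  | S, _, .capped k => P.cappedOK dmax S k
  | S, none, .frame sub => ETree.check P dmin dmax f ctx S (some P.rootBox) sub
  | _, some _, .frame _ => false
  | S, some B, .split axis cut lo hi =>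
      ETree.check P dmin dmax f ctx S (some (B.split axis cut).1) lo &&
        ETree.check P dmin dmax f ctx S (some (B.split axis cut).2) hi
  | _, none, .split _ _ _ _ => false
  | S, some B, .empty w => P.witnessOK S B w
  | _, none, .empty _ => false
  | _, some B, .aboveFacet l prec => P.facetOK f B l prec
  | _, none, .aboveFacet _ _ => false
  | _, some B, .accept pat M σ => P.acceptOK B pat M σ
  | _, none, .accept _ _ _ => false

/-- An **extended census certificate**: constraint lists with their trees, in dependency order. [folklore] -/
abbrev ECensus : Type := List (List Constraint × ETree)

/-- Check the entries in order, each against the context of the earlier ones. [folklore] -/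
def ECensus.checkFrom (P : Spec) (dmin dmax : ℕ) (f : Option (ℕ × ℕ × ℕ)) :
    Array (List Constraint) → ECensus → Bool
  | _, [] => true
  | ctx, (S, tr) :: rest =>
      tr.check P dmin dmax f ctx S none && ECensus.checkFrom P dmin dmax f (ctx.push S) rest

/-- **The extended census checker**: the data are sound (`okB`), every entry checks, and some
entry has the target constraint list `S`. [folklore] -/
def ECensus.check (P : Spec) (dmin dmax : ℕ) (f : Option (ℕ × ℕ × ℕ)) (S : List Constraint)
    (C : ECensus) : Bool :=
  P.okB && ECensus.checkFrom P dmin dmax f #[] C && C.any fun e => decide (e.1 = S)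

/-! ### A toy census, checked in the kernel -/

/-- A toy specification: four unit vectors, pairs within `1/10` or at least `3` apart (impossible
for unit vectors), no anchors (an infeasibility census). [folklore] -/
def toyESpec : Spec where
  n := 4
  rlo := 1
  rhi := 1
  dlo := 0
  dhi := 1 / 10
  gap := 3
  eta := 1
  eps := 0
  anchors := []

/-- A toy census for the degree window `[2, 2]` without facet condition: "pair `(0,1)` far" is
infeasible (entry 0: frame, a split, the exclusion test on both halves); the other far pairs at
`0` by relabelling (entries 1, 2); the target entry 3 (`S = []`) splits on the three pairs at `0`:
three bonds are `capped`, two far pairs are `torn`, the rest are references. [folklore] -/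
def toyECensus : ECensus :=
  [([(0, 1, false)], .frame (.split 5 0 (.empty (.farLo 0 1)) (.empty (.farLo 0 1)))),
   ([(0, 2, false)], .ref [0, 2, 1, 3] 0),
   ([(0, 3, false)], .ref [0, 3, 2, 1] 0),
   ([], .case 0 1
      (.case 0 2 (.case 0 3 (.capped 0) (.ref [0, 1, 2, 3] 2)) (.ref [0, 1, 2, 3] 1))
      (.case 0 2 (.ref [0, 1, 2, 3] 0) (.torn 0)))]

/-- The toy census is accepted (kernel evaluation of the checker). [folklore] -/
theorem toyECensus_check : ECensus.check toyESpec 2 2 none [] toyECensus = true := by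
  decide +kernel

/-- A box of width `1/64` per coordinate around `t 0 = (0,0,1)`, `t 1 = (1,0,0)`, `t 2 = (0,1,0)`,
`t 3 = (37/64)(1,1,1)`: the point `t 3` lies strictly ABOVE the plane through `t 0, t 1, t 2`. [folklore] -/
def toyFacetBox : Box :=
  [(0, 1 / 64), (0, 1 / 64), (63 / 64, 1), (63 / 64, 1), (0, 1 / 64), (0, 1 / 64),
    (0, 1 / 64), (63 / 64, 1), (0, 1 / 64), (36 / 64, 37 / 64), (36 / 64, 37 / 64), (36 / 64, 37 / 64)]

/-- The facet leaf fires on `toyFacetBox` for the facet labels `(0, 1, 2)` and `l = 3`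
(kernel evaluation, precision `2⁻¹⁰`). [folklore] -/
theorem toyFacet_check :
    ETree.check toyESpec 2 2 (some (0, 1, 2)) #[] [] (some toyFacetBox) (.aboveFacet 3 10) = true := by
  decide +kernel

end ShellCensus

end Literature.Geometry.DiscreteGeometry
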